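import Literature.AlgebraicGeometry.Motives.FamiliesVHSTensorConstraintsIso
import HarnessLib

/-!
# Isometries of VHS data are stable under `⊗`, `cast`, Tate twists and tensor powers; isomorphic polarized VHS data have the same Cattani–Deligne–Kaplan
# loci for all their tensor constructions

Topic `Literature/AlgebraicGeometry/Motives` (namespace `Literature.AlgebraicGeometry.Motives.VHSData`), lane `lit-hodgefound` (seat `p08`, row g57-#13).
ONE DEFINITION WITH BODY (`Iso.ofEq`, the isomorphism along an equality of VHS data) and THEOREMS; no named fact, no instance, no notation (D-0026 net
debt `0`).  Sequel of `Motives/FamiliesVHSIso` (`VHSData.Iso`, `Hom.IsIsometry`, `Iso.hodgeLocusOfNormLe_eq`), `Motives/FamiliesVHSTensorMorphism ∕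
TensorPower` (`φ ⊗ ψ`, `φ^{⊗m}`) and `Motives/FamiliesVHSTensorConstraintsIso` (`Iso.tensorPow`).

PRINTED SOURCES.  P. Deligne, J. Milne, *Tannakian categories*, LNM 900 (1982), §1 (functoriality of `⊗`) and Ex. 2.31 (polarized Hodge structures:
the polarization of a tensor product is the product form).  E. Cattani, P. Deligne, A. Kaplan, *On the locus of Hodge classes*, J. AMS 8 (1995), §1,
Thm 1.1 (the loci `S^{(K)} = {(s,u) : u Hodge, Q(u,u) ≤ K}`, visibly invariant under isometric isomorphisms).  W. Schmid, *Variation of Hodge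
structure*, §2.  P. Deligne, *Équations différentielles à points singuliers réguliers*, LNM 163 (1970), I.1.

* §1 `Hom.appRat_tensor_tmul` (`(φ ⊗ ψ)_ℚ (x₁ ⊗ x₂) = φ_ℚ x₁ ⊗ ψ_ℚ x₂`), **`Hom.IsIsometry.tensor`**, `Hom.isIsometry_castMap_iff`,
  `Hom.isIsometry_tateTwist_iff`, **`Hom.IsIsometry.tensorPow`**.
* §2 **`Iso.ofEq`** (`D = D'` gives `D ≅ D'`, an isometry), and the isometric isomorphisms `Iso.tensor`, `Iso.castMap`, `Iso.tateTwist`, `Iso.tensorPow` of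
  isometric isomorphisms.
* §3 **consequences for the CDK loci**: isometrically isomorphic `D₁ ≅ D₁'`, `D₂ ≅ D₂'` have `hodgeLocusOfNormLe (D₁ ⊗ D₂) = hodgeLocusOfNormLe (D₁' ⊗ D₂')`,
  `hodgeLocusOfNormLe (D^{⊗m}) = hodgeLocusOfNormLe (D'^{⊗m})`, `hodgeLocusOfNormLe (D(j)) = hodgeLocusOfNormLe (D'(j))`.

HONEST SCOPE: as for every `VHSData`, holomorphy ∕ transversality are not recorded.  (Duals: the form of `D^∨` is transported through `Q`; its
isometry statement is not made here.)

## References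

* [DeligneMilne1982Tannakian] P. Deligne, J. S. Milne, *Tannakian categories*, in LNM 900 (1982), §1, Ex. 2.31.
* [CattaniDeligneKaplan1995] E. Cattani, P. Deligne, A. Kaplan, *On the locus of Hodge classes*, J. Amer. Math. Soc. 8 (1995), §1, Thm 1.1.
* [Schmid1973] W. Schmid, *Variation of Hodge structure: the singularities of the period mapping*, Invent. Math. 22 (1973), §2.
* [Deligne1970] P. Deligne, *Équations différentielles à points singuliers réguliers*, LNM 163 (1970), I.1.
-/

noncomputable section

open CategoryTheory
open scoped TensorProduct

namespace Literature.AlgebraicGeometry.Motives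

namespace VHSData

variable {S : Type} [TopologicalSpace S] {k k' k₁ k₂ : ℤ}

/-! ## §1 Isometries are stable under the tensor operations -/

section Tensor

variable {D₁ D₁' : VHSData S k₁} {D₂ D₂' : VHSData S k₂}

/-- A morphism out of `D₁ ⊗ D₂` is an isometry as soon as it is one on pure tensors (bilinearity). [folklore] -/
private theorem isIsometry_of_forall_tmul {D' : VHSData S (k₁ + k₂)} (φ : Hom (D₁.tensor D₂) D')
    (h : ∀ (s : S) (x₁ y₁ : D₁.V.fiber s) (x₂ y₂ : D₂.V.fiber s),
      (D'.form s).form (φ.appRat s (x₁ ⊗ₜ[ℚ] x₂)) (φ.appRat s (y₁ ⊗ₜ[ℚ] y₂)) = ((D₁.tensor D₂).form s).form (x₁ ⊗ₜ[ℚ] x₂) (y₁ ⊗ₜ[ℚ] y₂)) :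
    φ.IsIsometry := fun s x y => by
  have key : (D'.form s).form.compl₁₂ (φ.appRat s) (φ.appRat s) = ((D₁.tensor D₂).form s).form :=
    TensorProduct.ext' fun x₁ x₂ => TensorProduct.ext' fun y₁ y₂ => h s x₁ y₁ x₂ y₂
  exact LinearMap.congr_fun (LinearMap.congr_fun key x) y

/-- **`(φ ⊗ ψ)_ℚ (x₁ ⊗ x₂) = φ_ℚ x₁ ⊗ ψ_ℚ x₂`** (the rationalization of `φ ⊗ ψ` is `φ_ℚ ⊗ ψ_ℚ`, `homRat_tensorMap`). [cite: Deligne1970, I.1] -/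
theorem Hom.appRat_tensor_tmul (φ : Hom D₁ D₁') (ψ : Hom D₂ D₂') (s : S) (x₁ : D₁.V.fiber s) (x₂ : D₂.V.fiber s) :
    (φ.tensor ψ).appRat s (x₁ ⊗ₜ[ℚ] x₂) = φ.appRat s x₁ ⊗ₜ[ℚ] ψ.appRat s x₂ :=
  LinearMap.congr_fun (homRat_tensorMap φ ψ s) (x₁ ⊗ₜ[ℚ] x₂)

/-- **The tensor product of two isometries is an isometry**: `(Q₁' ⊗ Q₂')(φx₁ ⊗ ψx₂, φy₁ ⊗ ψy₂) = Q₁'(φx₁, φy₁) Q₂'(ψx₂, ψy₂) = Q₁(x₁,y₁) Q₂(x₂,y₂)`.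
[cite: DeligneMilne1982Tannakian, §1 and Ex. 2.31] -/
theorem Hom.IsIsometry.tensor {φ : Hom D₁ D₁'} {ψ : Hom D₂ D₂'} (hφ : φ.IsIsometry) (hψ : ψ.IsIsometry) : (φ.tensor ψ).IsIsometry :=
  isIsometry_of_forall_tmul (φ.tensor ψ) fun s x₁ y₁ x₂ y₂ => by
    rw [Hom.appRat_tensor_tmul, Hom.appRat_tensor_tmul, tensor_form_form_tmul, tensor_form_form_tmul, hφ, hψ]

/-- `castMap` does not change the lattice maps nor the forms: `φ.castMap h` is an isometry iff `φ` is. [cite: Schmid1973, §2] -/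
theorem Hom.isIsometry_castMap_iff {D D' : VHSData S k} (φ : Hom D D') (h : k = k') : (φ.castMap h).IsIsometry ↔ φ.IsIsometry := Iff.rfl

/-- `φ(j)` has the lattice maps and forms of `φ`: it is an isometry iff `φ` is. [cite: Schmid1973, §2] -/
theorem Hom.isIsometry_tateTwist_iff {D D' : VHSData S k} (φ : Hom D D') (j : ℤ) : (φ.tateTwist j).IsIsometry ↔ φ.IsIsometry := Iff.rfl

/-- **Tensor powers of an isometry are isometries.** [cite: DeligneMilne1982Tannakian, §1 and Ex. 2.31] -/
theorem Hom.IsIsometry.tensorPow {D D' : VHSData S k} {φ : Hom D D'} (hφ : φ.IsIsometry) (m : ℕ) : (Hom.tensorPow φ m).IsIsometry := by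
  induction m with
  | zero => exact Hom.isIsometry_id _
  | succ m ih => exact (Hom.isIsometry_castMap_iff _ _).2 (ih.tensor hφ)

end Tensor

/-! ## §2 Isomorphisms along equalities; isometric isomorphisms under the tensor operations -/

/-- **The isomorphism `D ≅ D'` along an equality `D = D'`** (identity lattice maps). [cite: Schmid1973, §2] -/
def Iso.ofEq {D D' : VHSData S k} (h : D = D') : Iso D D' := h ▸ Iso.refl D

/-- `Iso.ofEq rfl = Iso.refl`. [cite: Schmid1973, §2] -/
@[simp] theorem Iso.ofEq_rfl (D : VHSData S k) : Iso.ofEq (rfl : D = D) = Iso.refl D := rfl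

/-- `Iso.ofEq` is an isometry. [cite: Schmid1973, §2] -/
theorem Iso.isIsometry_ofEq_hom {D D' : VHSData S k} (h : D = D') : (Iso.ofEq h).hom.IsIsometry := by
  subst h
  exact Hom.isIsometry_id D

/-- `Iso.refl` is an isometry. [cite: Schmid1973, §2] -/
theorem Iso.isIsometry_refl_hom (D : VHSData S k) : (Iso.refl D).hom.IsIsometry := Hom.isIsometry_id D

/-- The composite of isometric isomorphisms is isometric. [cite: Schmid1973, §2] -/
theorem Iso.isIsometry_trans_hom {D₁ D₂ D₃ : VHSData S k} {e₁ : Iso D₁ D₂} {e₂ : Iso D₂ D₃} (h₁ : e₁.hom.IsIsometry) (h₂ : e₂.hom.IsIsometry) :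
    (e₁.trans e₂).hom.IsIsometry :=
  h₂.comp h₁

/-- The inverse of an isometric isomorphism is isometric (restated for `symm`). [cite: Schmid1973, §2] -/
theorem Iso.isIsometry_symm_hom {D₁ D₂ : VHSData S k} {e : Iso D₁ D₂} (h : e.hom.IsIsometry) : e.symm.hom.IsIsometry :=
  e.isIsometry_inv h

/-- `e₁ ⊗ e₂` is isometric for isometric `e₁`, `e₂`. [cite: DeligneMilne1982Tannakian, §1 and Ex. 2.31] -/
theorem Iso.isIsometry_tensor_hom {D₁ D₁' : VHSData S k₁} {D₂ D₂' : VHSData S k₂} {e₁ : Iso D₁ D₁'} {e₂ : Iso D₂ D₂'} (h₁ : e₁.hom.IsIsometry)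
    (h₂ : e₂.hom.IsIsometry) : (e₁.tensor e₂).hom.IsIsometry :=
  h₁.tensor h₂

/-- `e.castMap h` is isometric iff `e` is. [cite: Schmid1973, §2] -/
theorem Iso.isIsometry_castMap_hom_iff {D D' : VHSData S k} (e : Iso D D') (h : k = k') : (e.castMap h).hom.IsIsometry ↔ e.hom.IsIsometry := Iff.rfl

/-- `e(j)` is isometric iff `e` is. [cite: Schmid1973, §2] -/
theorem Iso.isIsometry_tateTwist_hom_iff {D D' : VHSData S k} (e : Iso D D') (j : ℤ) : (e.tateTwist j).hom.IsIsometry ↔ e.hom.IsIsometry := Iff.rfl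

/-- `e^{⊗m}` is isometric for isometric `e`. [cite: DeligneMilne1982Tannakian, §1 and Ex. 2.31] -/
theorem Iso.isIsometry_tensorPow_hom {D D' : VHSData S k} {e : Iso D D'} (h : e.hom.IsIsometry) (m : ℕ) : (e.tensorPow m).hom.IsIsometry :=
  h.tensorPow m

/-! ## §3 Isometrically isomorphic VHS data have the same CDK loci for all their tensor constructions -/

/-- **`D₁ ≅ D₁'`, `D₂ ≅ D₂'` isometric ⟹ the norm-bounded Hodge loci of `D₁ ⊗ D₂` and `D₁' ⊗ D₂'` coincide.** [cite: CattaniDeligneKaplan1995, §1, Thm 1.1] -/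
theorem Iso.hodgeLocusOfNormLe_tensor_eq {D₁ D₁' : VHSData S k₁} {D₂ D₂' : VHSData S k₂} (e₁ : Iso D₁ D₁') (e₂ : Iso D₂ D₂') (h₁ : e₁.hom.IsIsometry)
    (h₂ : e₂.hom.IsIsometry) (p K : ℤ) : (D₁.tensor D₂).hodgeLocusOfNormLe p K = (D₁'.tensor D₂').hodgeLocusOfNormLe p K :=
  (e₁.tensor e₂).hodgeLocusOfNormLe_eq (h₁.tensor h₂) p K

/-- **`D ≅ D'` isometric ⟹ the norm-bounded Hodge loci of `D^{⊗m}` and `D'^{⊗m}` coincide.** [cite: CattaniDeligneKaplan1995, §1, Thm 1.1] -/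
theorem Iso.hodgeLocusOfNormLe_tensorPow_eq {D D' : VHSData S k} (e : Iso D D') (h : e.hom.IsIsometry) (m : ℕ) (p K : ℤ) :
    (D.tensorPow m).hodgeLocusOfNormLe p K = (D'.tensorPow m).hodgeLocusOfNormLe p K :=
  (e.tensorPow m).hodgeLocusOfNormLe_eq (h.tensorPow m) p K

/-- **`D ≅ D'` isometric ⟹ the norm-bounded Hodge loci of `D(j)` and `D'(j)` coincide.** [cite: CattaniDeligneKaplan1995, §1, Thm 1.1] -/
theorem Iso.hodgeLocusOfNormLe_tateTwist_eq {D D' : VHSData S k} (e : Iso D D') (h : e.hom.IsIsometry) (j : ℤ) (p K : ℤ) :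
    (D.tateTwist j).hodgeLocusOfNormLe p K = (D'.tateTwist j).hodgeLocusOfNormLe p K :=
  (e.tateTwist j).hodgeLocusOfNormLe_eq ((e.isIsometry_tateTwist_hom_iff j).2 h) p K

/-- The flat-transport Hodge loci of `u₁ ⊗ u₂` and `e₁u₁ ⊗ e₂u₂` coincide (no isometry needed). [cite: CattaniDeligneKaplan1995, §1] -/
theorem Iso.setOf_exists_isHodgeAt_transport_tensor_tmul_eq {D₁ D₁' : VHSData S k₁} {D₂ D₂' : VHSData S k₂} (e₁ : Iso D₁ D₁') (e₂ : Iso D₂ D₂')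
    (s : S) (p : ℤ) (u₁ : D₁.VZ.fiber s) (u₂ : D₂.VZ.fiber s) :
    {t | ∃ γ : Path.Homotopic.Quotient s t, (D₁'.tensor D₂').IsHodgeAt t p ((D₁'.tensor D₂').VZ.transport γ (e₁.hom.app s u₁ ⊗ₜ[ℤ] e₂.hom.app s u₂))} =
      {t | ∃ γ : Path.Homotopic.Quotient s t, (D₁.tensor D₂).IsHodgeAt t p ((D₁.tensor D₂).VZ.transport γ (u₁ ⊗ₜ[ℤ] u₂))} :=
  (e₁.tensor e₂).setOf_exists_isHodgeAt_transport_eq s p (u₁ ⊗ₜ[ℤ] u₂)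

end VHSData

end Literature.AlgebraicGeometry.Motives

end
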